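import Summits.QuantumFields.YangMills.Theorems.CovariantDischargeFarMeanThreshold
import Summits.QuantumFields.YangMills.Theorems.CovariantDischargeDoorExponentRows
import Summits.QuantumFields.YangMills.Theorems.CovariantDischargeDoorPhi
import Summits.QuantumFields.YangMills.Theorems.CovariantDischargeDoorMeans
import Summits.QuantumFields.YangMills.Theorems.CovariantDischargePlaqPairSum
import Literature.MathematicalPhysics.QuantumFieldTheory.Balaban1983to89.T4ReTrLipUnitary
import HarnessLib

/-!
# Line «sandwich_discharge» on crux `HistoryTailL` (stmt-QuantumFields-19936), stub `stub_sandwichSweepGapCapped` (S′), B6 door —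
# «THE SIGNAL HALF OF THE DOOR, PER CONFIGURATION»: in the comb gauge at `c₀ = embIter j p.src`, the sweep's signal functional
# `SIG = Σ_q s·(d₁a_T)_q·⟪v, Im W̃(∂q)⟫` is at least `s·θ∕2` whenever the stub's window∕coarse hypotheses hold and the (η) errors are `≤ θ∕64`

Cell `ym3-torus` (YM ladder rung R3 = continuum SU(2) Yang–Mills on the three-torus — a RUNG, NOT the Clay problem: not d = 4, not infinite volume,
not a mass gap); WIDTH seat `ym3-torus-px8` gen 8 (the B6 door pen); `--supports stmt-QuantumFields-19936` (helper).  THEOREMS ONLY (0 `def`).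

WHY.  DOOR SKELETON v5 (HOME `ym3-torus-px8/g8/DOOR-SKELETON-v5-px8g8.lean` 7e519bd5, kernel certificate cde9d9cd rc 0 · 0 sorry) proves the capped stub as ONE
theorem of ≈ 3·10⁶ heartbeats; the cell's budget rule (README, №24 (a): ≤ 400k per declaration) and the 400-line rule want it SPLIT.  This file is the per-configuration
SIGNAL half, with every scalar (η)-fact entering as a hypothesis (they are discharged once, in the stub file, by ✓`CovariantDischargeDoorSignalRows` (px7 g8),
✓`CovariantDischargeDoorGlueRows.bulk_conjunct_le_of_le`, ✓`CovariantDischargeDoorGuardRows` (px18 g6)):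
* §1 `far_mean_weight_le` — (S6): `(L^j)²∕(L^h)² · θ_{Λb}(K−h) ≤ θ_b(K−j)∕64` for `h = j + m`, `(64√3Λ)² < L^m` (✓p718583 B4);
* §2 `thetaK_le_theta` — `θ_b(K) ≤ θ_b(K−j)` once `4^{p₀} ≤ L^j` (✓p717307 ratio);
* §3 `signal_arith` — the knit of (S2)…(S7) in free reals: `θ ≤ PAIRING`;
* §4 ★★`door_signal` — (S0) ✓p725365 `exists_doorPhi` (px6 g8; `hplaq` by gauge invariance, `hlink` by the lasso ✓p718700 about `c₀` at the re-centred radius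
  `r = 2R + L^h`, ✓`exists_recentred`), (S1) ✓p719993, (S2) the profile socket's pairing row (hypothesis `hPair` = ✓p722908 (P″) at `Φ`), (S3)(S4) ✓p725860
  `door_mean_le`∕`door_mean_far_le` (px18 g6), then `signal_arith`: `s·θ∕2 ≤ SIG`.
HONEST SCOPE: per-configuration bookkeeping over landed bricks; NOTHING here proves the capped stub, `HistoryTailL`, or any summit statement; YM₃ on T³ is rung R3,
not Clay. [cite: Balaban1985Averaging, (10)-(12) p.19, (19)-(20) p.21, p.24; Balaban1985UV3, (7) p.257]
-/

noncomputable section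

open scoped BigOperators RealInnerProductSpace Matrix.Norms.L2Operator
open MeasureTheory
open Literature.MathematicalPhysics.QuantumFieldTheory.Balaban1983to89
open Literature.MathematicalPhysics.QuantumFieldTheory.Balaban1983to89.T4Continuum
open Literature.MathematicalPhysics.QuantumFieldTheory.Balaban1983to89.T3ContinuumYM3Torus
open Literature.MathematicalPhysics.QuantumFieldTheory.Balaban1983to89.T3UnitScaleTilt
open Literature.MathematicalPhysics.QuantumFieldTheory.Balaban1983to89.T3Thresholds (θBal_eq coupling_le_one)
open Literature.MathematicalPhysics.QuantumFieldTheory.Balaban1983to89.T3ThresholdSmallness (sqrt_coupling_pos_le)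
open Literature.MathematicalPhysics.QuantumFieldTheory.Balaban1983to89.T4CubeChartGnomonic (SU2)
open Literature.MathematicalPhysics.QuantumFieldTheory.Balaban1983to89.T4ExpWindowSmallField (imVec)
open Literature.MathematicalPhysics.QuantumFieldTheory.Balaban1983to89.B10Eq27TorusAxialLog (transl axialT)
open Literature.MathematicalPhysics.QuantumFieldTheory.Balaban1983to89.B4Eq19LatticeOperators (Zd box mem_box unitVec)
open Literature.MathematicalPhysics.QuantumFieldTheory.Balaban1983to89.B15DeterminingSets (embIter)
open Literature.MathematicalPhysics.QuantumFieldTheory.Balaban1983to89.T4ReTrLipUnitary (plaqSmall_gaugeAct_iff)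
open Literature.MathematicalPhysics.QuantumLattice (su2Quat)
open B5Eq118OneStroke (iterBlock)
open LatticeFieldCalculus (runSite)
open Summit.QuantumFields.YangMills.Theorems.CovariantDischargePlaqPairSum (sum_curl_mul_eq_two_mul_sum_plaq)
open Summit.QuantumFields.YangMills.Theorems.CovariantDischargeDoorSites (exists_recentred)
open Summit.QuantumFields.YangMills.Theorems.CovariantDischargeDoorPhi (exists_doorPhi)
open Summit.QuantumFields.YangMills.Theorems.CovariantDischargeDoorMeans (door_mean_le door_mean_far_le)
open Summit.QuantumFields.YangMills.Theorems.CovariantDischargeCombLassoStokes (dist1_gaugeAct_axialT_le_of_ball)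

namespace Summit.QuantumFields.YangMills.Theorems.CovariantDischargeDoorSignal

/-! ## §1 (S6) the far mean's weight -/

/-- ★ **(S6)**: for `1 < L`, `0 < γ ≤ 1`, `0 ≤ b`, `0 ≤ p₀`, `1 < Λ`, `h = j + m ≤ K` and `(64√3Λ)² < L^m`:
`((L^j)²∕(L^h)²)·θ_{Λb}(K−h) ≤ θ_b(K−j)∕64` (`(L^j)²∕(L^h)² = q⁴`, `q := (√L⁻¹)^m`, B4: `q·θ_{Λb}(K−h) ≤ Λ·θ_b(K−j)`, `q·64√3Λ ≤ 1`). [cite: Balaban1985UV3, (7) p.257] -/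
theorem far_mean_weight_le {L : ℕ} (hL : 1 < L) {γ b Λ p₀ : ℝ} (hγ : 0 < γ) (hγ1 : γ ≤ 1) (hb0 : 0 ≤ b) (hp : 0 ≤ p₀) (hΛ : 1 < Λ)
    {j m h K : ℕ} (hh : h = j + m) (hhK : h ≤ K) (hm : (64 * Real.sqrt 3 * Λ) ^ 2 < (L : ℝ) ^ m) :
    (((L : ℝ) ^ j) ^ 2 / ((L : ℝ) ^ h) ^ 2) * θBal L γ (Λ * b) p₀ (K - h) ≤ θBal L γ b p₀ (K - j) / 64 := by
  have hjh : j ≤ h := by omega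
  have hL0 : (0 : ℝ) < L := by exact_mod_cast (lt_trans Nat.zero_lt_one hL)
  have hθ0 : 0 ≤ θBal L γ b p₀ (K - j) := by
    rw [θBal_eq]
    have hg := sqrt_coupling_pos_le (L := L) hL.le hγ (K - j)
    exact mul_nonneg hg.1.le (B10.pFun_nonneg b p₀ _ hb0 hg.1 (coupling_le_one hL.le hγ hγ1 _))
  have hB4 := Summit.QuantumFields.YangMills.Theorems.CovariantDischargeFarMeanThreshold.sqrt_inv_pow_mul_θBal_mul_le
    (L := L) (γ := γ) (b₀ := b) (p₀ := p₀) hL.le hγ hγ1 hb0 hp (by linarith : (0 : ℝ) ≤ Λ) hjh hhK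
  rw [show h - j = m by omega] at hB4
  have hq0 : 0 < Real.sqrt ((L : ℝ)⁻¹) ^ m := pow_pos (Real.sqrt_pos.mpr (inv_pos.mpr hL0)) _
  have hq1 : Real.sqrt ((L : ℝ)⁻¹) ^ m ≤ 1 := by
    refine pow_le_one₀ (Real.sqrt_nonneg _) ?_
    rw [Real.sqrt_le_one]
    exact inv_le_one_of_one_le₀ (by exact_mod_cast hL.le)
  have hq2 : (Real.sqrt ((L : ℝ)⁻¹) ^ m) ^ 2 = (((L : ℝ) ^ m)⁻¹) :=
    Summit.QuantumFields.YangMills.Theorems.CovariantDischargeThresholdRatio.sqrt_inv_pow_sq L m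
  have hratio_eq : ((L : ℝ) ^ j) ^ 2 / ((L : ℝ) ^ h) ^ 2 = (Real.sqrt ((L : ℝ)⁻¹) ^ m) ^ 4 := by
    rw [show (4 : ℕ) = 2 * 2 from rfl, pow_mul, hq2, hh, pow_add]
    have hLj : (L : ℝ) ^ j ≠ 0 := pow_ne_zero _ hL0.ne'
    have hLm : (L : ℝ) ^ m ≠ 0 := pow_ne_zero _ hL0.ne'
    field_simp
  have hqc : Real.sqrt ((L : ℝ)⁻¹) ^ m * (64 * Real.sqrt 3 * Λ) ≤ 1 := by
    have hc0 : 0 ≤ 64 * Real.sqrt 3 * Λ := by positivity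
    have hsq : (Real.sqrt ((L : ℝ)⁻¹) ^ m * (64 * Real.sqrt 3 * Λ)) ^ 2 ≤ 1 := by
      rw [mul_pow, hq2, inv_mul_le_iff₀ (pow_pos hL0 m)]
      linarith only [hm]
    have hy0 : 0 ≤ Real.sqrt ((L : ℝ)⁻¹) ^ m * (64 * Real.sqrt 3 * Λ) := mul_nonneg hq0.le hc0
    exact (pow_le_one_iff_of_nonneg hy0 two_ne_zero).mp hsq
  have h3 : (1 : ℝ) ≤ Real.sqrt 3 := by
    rw [show (1 : ℝ) = Real.sqrt 1 by rw [Real.sqrt_one]]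
    exact Real.sqrt_le_sqrt (by norm_num)
  rw [hratio_eq]
  set θ := θBal L γ b p₀ (K - j) with hθ_def
  set q := Real.sqrt ((L : ℝ)⁻¹) ^ m with hq_def
  have hΛ0 : (0 : ℝ) ≤ Λ := by linarith
  have step1 : q ^ 4 * θBal L γ (Λ * b) p₀ (K - h) ≤ q ^ 3 * (Λ * θ) := by
    rw [show q ^ 4 * θBal L γ (Λ * b) p₀ (K - h) = q ^ 3 * (q * θBal L γ (Λ * b) p₀ (K - h)) by ring]
    exact mul_le_mul_of_nonneg_left hB4 (by positivity)
  have step2 : q ^ 3 * (Λ * θ) ≤ q * (Λ * θ) := by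
    have : q ^ 3 ≤ q := by
      calc q ^ 3 ≤ q ^ 1 := pow_le_pow_of_le_one hq0.le hq1 (by norm_num)
        _ = q := pow_one _
    exact mul_le_mul_of_nonneg_right this (mul_nonneg hΛ0 hθ0)
  have step3 : q * (Λ * θ) ≤ θ / 64 := by
    have hqΛ : q * Λ * 64 ≤ 1 := by
      have h0 : 0 ≤ q * Λ * 64 := by positivity
      have h1 : q * Λ * 64 ≤ q * Λ * 64 * Real.sqrt 3 := le_mul_of_one_le_right h0 h3
      have h2 : q * Λ * 64 * Real.sqrt 3 = q * (64 * Real.sqrt 3 * Λ) := by ring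
      rw [h2] at h1
      exact h1.trans hqc
    have h4 := mul_le_mul_of_nonneg_right hqΛ hθ0
    have h5 : q * (Λ * θ) = (q * Λ * 64) * θ / 64 := by ring
    rw [h5]
    linarith only [h4]
  linarith only [step1, step2, step3]

/-! ## §2 `θ_K ≤ θ` past the slot `4^{p₀} ≤ L^j` -/

/-- ★ `θ_b(K) ≤ θ_b(K−j)` for `2j ≤ K` once `4^{p₀} ≤ L^j` (the ratio letter's factor `2^{p₀}(√L⁻¹)^j` is then `≤ 1`). [cite: Balaban1985UV3, (7) p.257] -/
theorem thetaK_le_theta {L : ℕ} (hL : 1 ≤ L) {γ b p₀ : ℝ} (hγ : 0 < γ) (hγ1 : γ ≤ 1) (hb0 : 0 ≤ b) (hp : 0 ≤ p₀) {K j : ℕ}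
    (h2jK : 2 * j ≤ K) (h4 : (4 : ℝ) ^ p₀ ≤ (L : ℝ) ^ j) : θBal L γ b p₀ K ≤ θBal L γ b p₀ (K - j) := by
  have hθ0 : 0 ≤ θBal L γ b p₀ (K - j) := by
    rw [θBal_eq]
    have hg := sqrt_coupling_pos_le (L := L) hL hγ (K - j)
    exact mul_nonneg hg.1.le (B10.pFun_nonneg b p₀ _ hb0 hg.1 (coupling_le_one hL hγ hγ1 _))
  have hr := Summit.QuantumFields.YangMills.Theorems.CovariantDischargeThresholdRatio.θBal_le_two_rpow_mul_sqrt_inv_pow_mul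
    hL hγ hγ1 hb0 hp h2jK
  have hL0 : (0 : ℝ) < (L : ℝ) ^ j := lt_of_lt_of_le (by positivity) h4
  have hq2 : ((2 : ℝ) ^ p₀ * Real.sqrt ((L : ℝ)⁻¹) ^ j) ^ 2 = (4 : ℝ) ^ p₀ * ((L : ℝ) ^ j)⁻¹ := by
    rw [mul_pow, Summit.QuantumFields.YangMills.Theorems.CovariantDischargeDoorExponentRows.sqrt_inv_pow_sq,
      ← Summit.QuantumFields.YangMills.Theorems.CovariantDischargeDoorExponentRows.two_rpow_mul_two_rpow, sq]
  have hle1sq : ((2 : ℝ) ^ p₀ * Real.sqrt ((L : ℝ)⁻¹) ^ j) ^ 2 ≤ 1 := by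
    rw [hq2, mul_inv_le_iff₀ hL0, one_mul]; exact h4
  have hnn : (0 : ℝ) ≤ (2 : ℝ) ^ p₀ * Real.sqrt ((L : ℝ)⁻¹) ^ j := by positivity
  have hle1 : (2 : ℝ) ^ p₀ * Real.sqrt ((L : ℝ)⁻¹) ^ j ≤ 1 := (pow_le_one_iff_of_nonneg hnn two_ne_zero).mp hle1sq
  calc θBal L γ b p₀ K ≤ (2 : ℝ) ^ p₀ * Real.sqrt ((L : ℝ)⁻¹) ^ j * θBal L γ b p₀ (K - j) := hr
    _ ≤ 1 * θBal L γ b p₀ (K - j) := mul_le_mul_of_nonneg_right hle1 hθ0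
    _ = θBal L γ b p₀ (K - j) := one_mul _

/-! ## §3 The signal knit in free reals -/

/-- **THE SIGNAL KNIT, ABSTRACTLY**: from the pairing row `|PAIR − (2·Mj − ρ·(2·Mh))| ≤ Ec + Ed`, the two mean rows `|Mj − fj| ≤ Aj`, `|Mh| ≤ xh + Ah`, the window
`3θ∕4 ≤ fj`, (S6) `ρ·xh ≤ θ∕64` and the four (η) budgets `Aj, ρ·Ah, Ec, Ed ≤ θ∕64` (`ρ ≥ 0`): `θ ≤ PAIR`. [folklore] -/
theorem signal_arith {PAIR Mj Mh fj θ xh ρ Ec Ed Aj Ah : ℝ} (hθ : 0 ≤ θ) (hρ : 0 ≤ ρ)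
    (hS2 : |PAIR - (2 * Mj - ρ * (2 * Mh))| ≤ Ec + Ed) (hS3 : |Mj - fj| ≤ Aj) (hS4 : |Mh| ≤ xh + Ah) (hS5 : 3 / 4 * θ ≤ fj)
    (hS6 : ρ * xh ≤ θ / 64) (h7a : Aj ≤ θ / 64) (h7b : ρ * Ah ≤ θ / 64) (h7c : Ec ≤ θ / 64) (h7d : Ed ≤ θ / 64) : θ ≤ PAIR := by
  have a2 := (abs_le.mp hS2).1
  have a3 := (abs_le.mp hS3).1
  have a4 := (abs_le.mp hS4).2
  have hm4 : ρ * Mh ≤ ρ * (xh + Ah) := mul_le_mul_of_nonneg_left a4 hρ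
  have hre : ρ * (xh + Ah) = ρ * xh + ρ * Ah := by ring
  rw [hre] at hm4
  linarith

/-! ## §4 The signal half of the door -/

set_option maxHeartbeats 400000 in
-- hb: four large-statement brick applications (`exists_doorPhi`, the (P″) row, `door_mean_le`, `door_mean_far_le`) + the `set` bookkeeping measure ≈ 250k on the farm.
/-- ★★ **THE SIGNAL HALF OF THE DOOR, PER CONFIGURATION.**  Data: member `F`, level `K`, heights `j ≤ h` (`j + 2, h + 2 ≤ m + K`), the plaquette `p`, the far site
`Y` above it (nesting `hnest`), the unit axis `v`, the profile corner `C`, the comb centre `c₀ = embIter j p.src` with `val C ≤ val c₀ < val C + L^h`, the radii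
`R`, `r = 2R + L^h` (`2(r+1) ≤` period), the profile `aT` with its (P″) pairing row `hPair`, scalars `θ, θ_K ≤ 1, x_h, s ≥ 0`; configuration `V` with
`PlaqSmall θ_K V`, `PlaqSmall x_h (Ū^h V)`, the window `3θ∕4 ≤ ⟪v, Im Ū^j[V](∂p)⟫`, the two D6-MEANS guards, (S6) and the four (η) budgets.  Conclusion:
`s·θ∕2 ≤ Σ_q s·(a_T(b₁)+a_T(b₂)−a_T(b₃)−a_T(b₄))·⟪v, Im su2Quat(W̃(∂q))⟫`, `W̃ = V^{axialT V c₀}`. [cite: Balaban1985Averaging, (10)-(12) p.19, (19)-(20) p.21, p.24] -/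
theorem door_signal (F : T3Family) (K j h : ℕ) (hjh : j ≤ h) (hj2 : j + 2 ≤ F.m + K) (hh2 : h + 2 ≤ F.m + K)
    (p : Plaq (F.P K) j) (Y : Site (F.P K) h) (hnest : ∀ i, (p.src i).val / (F.P K).L ^ (h - j) = (Y i).val)
    (v : EuclideanSpace ℝ (Fin 3)) (hv : ‖v‖ = 1) (C c₀ : Site (F.P K) 0) (hc₀ : c₀ = embIter j p.src)
    (hc₀C : ∀ ν, (C ν).val ≤ (c₀ ν).val ∧ (c₀ ν).val < (C ν).val + (F.P K).L ^ h)
    (R r : ℕ) (hr : r = 2 * R + F.L ^ h) (hr1 : 2 * (r + 1) ≤ (F.P K).sitesPerDir 0)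
    (aT : PBond (F.P K) 0 → ℝ) {A_S A_B A_B' : ℝ}
    (hPair : ∀ (Φ : Site (F.P K) 0 → Fin (F.P K).d → Fin (F.P K).d → ℝ) (θ η : ℝ), 0 ≤ θ → (∀ x a b, Φ x b a = -Φ x a b) →
      (∀ w ∈ box (0 : Zd (F.P K).d) (2 * (R : ℤ) + 2), ∀ a b, |Φ (transl C w) a b| ≤ θ) →
      (∀ w ∈ box (0 : Zd (F.P K).d) (2 * (R : ℤ)), ∀ κ a b,
        |(Φ (transl C (w + unitVec κ)) a b - Φ (transl C w) a b) - (Φ (transl C (w + unitVec a)) κ b - Φ (transl C w) κ b)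
          + (Φ (transl C (w + unitVec b)) κ a - Φ (transl C w) κ a)| ≤ η) →
      |(∑ x : Site (F.P K) 0, ∑ a, ∑ b, ((aT ⟨x.shift a, b⟩ - aT ⟨x, b⟩) - (aT ⟨x.shift b, a⟩ - aT ⟨x, a⟩)) * Φ x a b)
          - (2 * ((((F.P K).L : ℝ) ^ (F.P K).d) ^ j)⁻¹ *
              (∑ x ∈ iterBlock j p.src, ∑ s ∈ Finset.range ((F.P K).L ^ j), ∑ t ∈ Finset.range ((F.P K).L ^ j), Φ (runSite (runSite x p.μ s) p.ν t) p.μ p.ν)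
            - ((((F.P K).L : ℝ) ^ j) ^ 2 / (((F.P K).L : ℝ) ^ h) ^ 2) * (2 * ((((F.P K).L : ℝ) ^ (F.P K).d) ^ h)⁻¹ *
              (∑ x ∈ iterBlock h Y, ∑ s ∈ Finset.range ((F.P K).L ^ h), ∑ t ∈ Finset.range ((F.P K).L ^ h), Φ (runSite (runSite x p.μ s) p.ν t) p.μ p.ν)))|
        ≤ θ * (A_S * (24 * (((F.P K).L : ℝ) ^ j) ^ 2 * ((F.P K).L : ℝ) ^ h) / R)
          + η / 3 * ((A_B + A_B' * (2 * (R : ℝ) + 2 * ((F.P K).L : ℝ) ^ h)) * (4 * (((F.P K).L : ℝ) ^ j) ^ 2)))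
    {θ θK xh s : ℝ} (hθ0 : 0 ≤ θ) (hθK0 : 0 ≤ θK) (hθK1 : θK ≤ 1) (hs0 : 0 ≤ s)
    (V : GaugeField (F.P K) 0 SU2) (hθK_small : PlaqSmall θK V)
    (hcoarse : PlaqSmall xh (Averaging.iter (fun i => BlockAveraging.blockAvg (P := F.P K) (j := i) T3UnitLawDensityEML.ℰp) h V))
    (hS5 : 3 / 4 * θ ≤ ⟪v, imVec (su2Quat (GaugeField.plaqHol
      (Averaging.iter (fun i => BlockAveraging.blockAvg (P := F.P K) (j := i) T3UnitLawDensityEML.ℰp) j V) p))⟫)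
    (hGj : 81 * ((((F.P K).d + 2) * (F.P K).L : ℕ) : ℝ) * ((4 * ((((F.P K).d + 2) * (F.P K).L : ℕ) : ℝ)) ^ j *
      ((((2 * (F.P K).d * (4 * (F.P K).L ^ j + 2) + 2 : ℕ) : ℝ) ^ 2 / 4) * θK)) ≤ 1)
    (hGh : 81 * ((((F.P K).d + 2) * (F.P K).L : ℕ) : ℝ) * ((4 * ((((F.P K).d + 2) * (F.P K).L : ℕ) : ℝ)) ^ h *
      ((((2 * (F.P K).d * (4 * (F.P K).L ^ h + 2) + 2 : ℕ) : ℝ) ^ 2 / 4) * θK)) ≤ 1)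
    (hS6 : ((((F.P K).L : ℝ) ^ j) ^ 2 / (((F.P K).L : ℝ) ^ h) ^ 2) * xh ≤ θ / 64)
    (h7a : Real.sqrt 3 * (13 * ((((2 * (F.P K).d * (4 * F.L ^ j + 2) + 2 : ℕ) : ℝ) ^ 2 / 4) * θK) ^ 2) * (((F.P K).L : ℝ) ^ j) ^ 2 + (Real.sqrt 3 * (100 * ((4 * ((((F.P K).d + 2) * (F.P K).L : ℕ) : ℝ)) ^ j) ^ 2 * ((((2 * (F.P K).d * (4 * F.L ^ j + 2) + 2 : ℕ) : ℝ) ^ 2 / 4) * θK) ^ 2)) ≤ θ / 64)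
    (h7b : ((((F.P K).L : ℝ) ^ j) ^ 2 / (((F.P K).L : ℝ) ^ h) ^ 2) * (Real.sqrt 3 * (13 * ((((2 * (F.P K).d * (4 * F.L ^ h + 2) + 2 : ℕ) : ℝ) ^ 2 / 4) * θK) ^ 2) * (((F.P K).L : ℝ) ^ h) ^ 2 + (Real.sqrt 3 * (100 * ((4 * ((((F.P K).d + 2) * (F.P K).L : ℕ) : ℝ)) ^ h) ^ 2 * ((((2 * (F.P K).d * (4 * F.L ^ h + 2) + 2 : ℕ) : ℝ) ^ 2 / 4) * θK) ^ 2))) ≤ θ / 64)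
    (h7c : (Real.sqrt 3 * θK) * (A_S * (24 * ((((F.P K).L : ℝ) ^ j) ^ 2) * ((F.P K).L : ℝ) ^ h) / R) ≤ θ / 64)
    (h7d : (Real.sqrt 3 * (60 * θK ^ 2 + 6 * ((((2 * (F.P K).d * r + 2 : ℕ) : ℝ) ^ 2 / 4) * θK) * θK)) / 3 * ((A_B + A_B' * (2 * (R : ℝ) + 2 * ((F.P K).L : ℝ) ^ h)) * (4 * (((F.P K).L : ℝ) ^ j) ^ 2)) ≤ θ / 64) :
    s * θ / 2 ≤ ∑ q : Plaq (F.P K) 0, s * (aT (T4WilsonLinkAffine.bond₁ q) + aT (T4WilsonLinkAffine.bond₂ q) -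
      aT (T4WilsonLinkAffine.bond₃ q) - aT (T4WilsonLinkAffine.bond₄ q)) *
        ⟪v, imVec (su2Quat (GaugeField.plaqHol (GaugeField.gaugeAct (axialT V c₀) V) q))⟫ := by
  classical
  set Wt : GaugeField (F.P K) 0 SU2 := GaugeField.gaugeAct (axialT V c₀) V with hWt_def
  set SIG : ℝ := ∑ q : Plaq (F.P K) 0, s * (aT (T4WilsonLinkAffine.bond₁ q) + aT (T4WilsonLinkAffine.bond₂ q) -
      aT (T4WilsonLinkAffine.bond₃ q) - aT (T4WilsonLinkAffine.bond₄ q)) * ⟪v, imVec (su2Quat (GaugeField.plaqHol Wt q))⟫ with hSIG_def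
  set βK : ℝ := ((((2 * (F.P K).d * r + 2 : ℕ) : ℝ) ^ 2 / 4) * θK) with hβK_def
  set ηΦ : ℝ := Real.sqrt 3 * (60 * θK ^ 2 + 6 * βK * θK) with hηΦ_def
  set βj : ℝ := ((((2 * (F.P K).d * (4 * F.L ^ j + 2) + 2 : ℕ) : ℝ) ^ 2 / 4) * θK) with hβj_def
  set Ej : ℝ := (Real.sqrt 3 * (100 * ((4 * ((((F.P K).d + 2) * (F.P K).L : ℕ) : ℝ)) ^ j) ^ 2 * βj ^ 2)) with hEj_def
  set βh : ℝ := ((((2 * (F.P K).d * (4 * F.L ^ h + 2) + 2 : ℕ) : ℝ) ^ 2 / 4) * θK) with hβh_def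
  set Eh : ℝ := (Real.sqrt 3 * (100 * ((4 * ((((F.P K).d + 2) * (F.P K).L : ℕ) : ℝ)) ^ h) ^ 2 * βh ^ 2)) with hEh_def
  obtain ⟨Φ, hΦanti, hΦbox, hΦd2, hΦplaq⟩ : ∃ Φ : Site (F.P K) 0 → Fin (F.P K).d → Fin (F.P K).d → ℝ,
      (∀ x a b, Φ x b a = -Φ x a b) ∧
      (∀ w ∈ box (0 : Zd (F.P K).d) (2 * (R : ℤ) + 2), ∀ a b, |Φ (transl C w) a b| ≤ Real.sqrt 3 * θK) ∧
      (∀ w ∈ box (0 : Zd (F.P K).d) (2 * (R : ℤ)), ∀ κ a b,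
        |(Φ (transl C (w + unitVec κ)) a b - Φ (transl C w) a b) - (Φ (transl C (w + unitVec a)) κ b - Φ (transl C w) κ b)
          + (Φ (transl C (w + unitVec b)) κ a - Φ (transl C w) κ a)| ≤ ηΦ) ∧
      (∀ q : Plaq (F.P K) 0, Φ q.src q.μ q.ν = ⟪v, imVec (su2Quat (GaugeField.plaqHol Wt q))⟫) := by
    -- BRICK D6-Φ ✓p725365 `exists_doorPhi` (px6 g8) (REAL): `hplaq` by gauge invariance, `hlink` by the lasso about `c₀` re-centred from `C`
    have hβK0 : 0 ≤ βK := by rw [hβK_def]; positivity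
    have hplaqW : ∀ q : Plaq (F.P K) 0, dist1 (GaugeField.plaqHol Wt q) ≤ θK := fun q =>
      (((plaqSmall_gaugeAct_iff θK (axialT V c₀) V).mpr hθK_small) q).le
    have hlinkW : ∀ w ∈ box (0 : Zd (F.P K).d) (2 * (R : ℤ)), ∀ μ, dist1 (Wt ⟨transl C w, μ⟩) ≤ βK := by
      intro w hw μ
      have hw' : w ∈ box (0 : Zd (F.P K).d) ((2 * R : ℕ) : ℤ) := by push_cast; exact hw
      obtain ⟨z, hz, hCz⟩ := exists_recentred C c₀ (R := 2 * R) (M := F.L ^ h) (fun ν => (hc₀C ν).1) (fun ν => (hc₀C ν).2) hw'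
      have hz' : ∀ ν, (z ν).natAbs ≤ r := fun ν => by rw [hr]; exact hz ν
      rw [hβK_def]
      exact dist1_gaugeAct_axialT_le_of_ball hθK0 hθK_small c₀ hr1 hz' ⟨transl C w, μ⟩ hCz
    exact exists_doorPhi Wt C v hv.le hθK0 hθK1 hβK0 (2 * (R : ℤ) + 2) (2 * (R : ℤ)) hplaqW hlinkW
  -- (S1) REAL: the door's signal functional is half FILE 8's ordered-pair pairing (✓p719993)
  have hS1 : SIG = s / 2 * ∑ x : Site (F.P K) 0, ∑ a, ∑ b,
      ((aT ⟨x.shift a, b⟩ - aT ⟨x, b⟩) - (aT ⟨x.shift b, a⟩ - aT ⟨x, a⟩)) * Φ x a b := by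
    have h2 := sum_curl_mul_eq_two_mul_sum_plaq (P := F.P K) (k := 0) aT Φ hΦanti
    have h3 : SIG = s * ∑ q : Plaq (F.P K) 0, (aT (T4WilsonLinkAffine.bond₁ q) + aT (T4WilsonLinkAffine.bond₂ q) -
        aT (T4WilsonLinkAffine.bond₃ q) - aT (T4WilsonLinkAffine.bond₄ q)) * Φ q.src q.μ q.ν := by
      rw [hSIG_def, Finset.mul_sum]
      exact Finset.sum_congr rfl fun q _ => by rw [hΦplaq q]; ring
    rw [h3, h2]
    ring
  -- (S2) REAL: FILE 8's pairing row at Φ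
  have hS2 := hPair Φ (Real.sqrt 3 * θK) ηΦ (mul_nonneg (Real.sqrt_nonneg _) hθK0) hΦanti hΦbox hΦd2
  -- names for the two one-stroke means and the window statistics
  set MEANj : ℝ := ((((F.P K).L : ℝ) ^ (F.P K).d) ^ j)⁻¹ *
      ∑ x ∈ iterBlock j p.src, ∑ s ∈ Finset.range ((F.P K).L ^ j), ∑ t ∈ Finset.range ((F.P K).L ^ j),
        Φ (runSite (runSite x p.μ s) p.ν t) p.μ p.ν with hMEANj_def
  set MEANh : ℝ := ((((F.P K).L : ℝ) ^ (F.P K).d) ^ h)⁻¹ *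
      ∑ x ∈ iterBlock h Y, ∑ s ∈ Finset.range ((F.P K).L ^ h), ∑ t ∈ Finset.range ((F.P K).L ^ h),
        Φ (runSite (runSite x p.μ s) p.ν t) p.μ p.ν with hMEANh_def
  set fj : ℝ := ⟪v, imVec (su2Quat (GaugeField.plaqHol
      (Averaging.iter (fun i => BlockAveraging.blockAvg (P := F.P K) (j := i) T3UnitLawDensityEML.ℰp) j V) p))⟫ with hfj_def
  have hS3 : |MEANj - fj| ≤ Real.sqrt 3 * (13 * βj ^ 2) * (((F.P K).L : ℝ) ^ j) ^ 2 + Ej := by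
    -- BRICK D6-MEANS(j) ✍`door_mean_le` (px18 g6) (REAL modulo olean)
    rw [hMEANj_def, hfj_def, hβj_def, hEj_def]
    exact door_mean_le (P := F.P K) hj2 V hθK_small hGj p c₀ hc₀ v hv Φ hΦplaq
  have hS4 : |MEANh| ≤ xh + Real.sqrt 3 * (13 * βh ^ 2) * (((F.P K).L : ℝ) ^ h) ^ 2 + Eh := by
    -- BRICK D6-MEANS(h) ✍`door_mean_far_le` (px18 g6) (REAL modulo olean)
    rw [hMEANh_def, hβh_def, hEh_def]
    exact door_mean_far_le (P := F.P K) hjh hh2 V hθK_small hGh p c₀ hc₀ Y hnest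
      hcoarse v hv Φ hΦplaq
  -- THE KNIT (`signal_arith`): `θ ≤ PAIR`, then `SIG = (s∕2)·PAIR`
  have hρ : 0 ≤ (((F.P K).L : ℝ) ^ j) ^ 2 / (((F.P K).L : ℝ) ^ h) ^ 2 := by positivity
  have hS2' := hS2
  simp only [mul_assoc (2 : ℝ)] at hS2'
  rw [← hMEANj_def, ← hMEANh_def] at hS2'
  have hS4' := hS4
  rw [add_assoc] at hS4'
  have hP := signal_arith hθ0 hρ hS2' hS3 hS4' hS5 hS6 h7a h7b h7c h7d
  rw [hS1]
  have := mul_le_mul_of_nonneg_left hP (by positivity : (0 : ℝ) ≤ s / 2)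
  linarith only [this]

end Summit.QuantumFields.YangMills.Theorems.CovariantDischargeDoorSignal

end
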